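import Summits.ABC.StewartYu.PadicW80Par
import HarnessLib

/-!
# The `(log p)`-normalised `p`-adic Waldschmidt parameter record `PadicW80ParL` — the definitions

Support file (plain definitions ONLY — every inequality is in the theorem-only sequels `PadicW80ParLA/B/C/…`;
no named facts), cell `abc-stewartyu` (seat p1, stub S5 of
memo-03 §4: "the `(log p)`-normalised parameter system"). Twin of `PadicW80Par.lean` (p1, WP-A4) with ONE new
symbol threaded through the whole parameter system: `ℓ` (to be instantiated as `ℓ = log p`, `p ≥ 3`), and one
harmless multiplier `Mcl ≥ 1` (the class price of a twisted set-up; `Mcl = 1` for principal units).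

What changes w.r.t. `PadicW80Par` (constants and the formulas for `T, h, L_b, Lⱼ, L_θ, J₀, t_J` are IDENTICAL):
the sizes carry the FLOORS `ℓ ≤ Vⱼ, V_θ, W` instead of `1 ≤ ·` (normalised sizes `nVⱼ = Vⱼ/ℓ`, `nV_θ`, `nW⋆ = W⋆/ℓ`,
`nG = G/ℓ`, all `≥ 1`, play the old roles); `G = m log(2¹⁷ m V_max) + ℓ` (additive floor);
`U = Mcl · Aᵐ m^{2m+3}/m! · (∏ nVⱼ) nV_θ · W⋆ · nG = Mcl · Aᵐ m^{2m+3}/m! · (∏ Vⱼ) V_θ · W⋆ · G / ℓ^{m+1}` (natural-log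
units, smallness hypothesis `‖Λ₀‖_p ≤ e^{−U}`: Yu's `(log p)^{−(m+2)}` in `ord_p` units); `S₀ = 2⌊c_S m nW⋆⌋` — the
Schwarz gain is `(log p)/2` PER zero (`KFinal`'s branch `p^{hL_b}/(√p)^{kpts·t}`), so `kpts·t ≈ 2ᵏ𝔘/ℓ` zeros suffice
where the landed `p`-free numerics (`log p ↦ log 3`) spent `2ᵏ𝔘`. Siegel count, budgets and endgame re-close with the
landed margins (`ℓ^{m+1}` cancels between `U` and `S₀^{m+1}`); design note HOME/p1/S5-logp-ledger.md.
All derived parameters and closed-form sizes of the landed chain are collected here (`𝔘, 𝔅, X, Vall, Lall, t_J` of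
`PadicW80ParB/C/D`, and p3's `E(c), PrV, Dmax_k, Mmax_k, DmaxH, MmaxH` of `PadicW80Budgets`), with the same formulas.

## References
* [Yu1990] K. Yu, *Linear forms in p-adic logarithms II*, Compositio Math. 74 (1990) — (2.8), (2.10), (2.13),
  (2.30)–(2.31) (pp. 31, 36): the floors `f℘ log p/D`, `V*_{n−1} ≥ p^{f℘}` and the normalisation `(f℘ log p)^{−(n+2)}`.
* [Waldschmidt1980] M. Waldschmidt, *A lower bound for linear forms in logarithms*, Acta Arith. 37 (1980) —
  §3.2 (3.7)–(3.14) (pp. 264–265).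
-/

noncomputable section

open Finset Real
open Literature.NumberTheory.Transcendental Literature.NumberTheory.Transcendental.Waldschmidt1980

namespace Summit.ABC.StewartYu

open PadicW80Par (cTp cSp cLp cLp' Ap mRp)

/-- **The `ℓ`-normalised parameters of the `p`-adic Waldschmidt descent.** `d ≥ 1` free logarithms of sizes
`ℓ ≤ Vⱼ ≤ V_max`, the eliminated one of size `ℓ ≤ V_θ ≤ V_max`, the coefficient bound `W ≥ ℓ`, the symbol
`ℓ ≥ 1` (`= log p`) and the class price `1 ≤ Mcl ≤ e^ℓ`.
[cite: Yu1990, (2.8)–(2.13) (p. 31)] -/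
structure PadicW80ParL (d : ℕ) where
  /-- sizes of the free logarithms -/
  V : Fin d → ℝ
  /-- a common bound for ALL the sizes (inside the logarithms `W⋆`, `G`) -/
  Vm : ℝ
  /-- the size of the eliminated logarithm -/
  Vθ : ℝ
  /-- the coefficient bound (`W ≥ log max |bⱼ|`) -/
  W : ℝ
  /-- the normalising symbol (`ℓ = log p`) -/
  ℓ : ℝ
  /-- the class price (`1` for principal units, `(p−1)/2` for the twist) -/
  Mcl : ℝ
  /-- `1 ≤ ℓ` (`p ≥ 3`) -/
  hℓ : 1 ≤ ℓ
  /-- `Vⱼ ≥ ℓ` -/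
  hVℓ : ∀ j, ℓ ≤ V j
  /-- `Vⱼ ≤ V_max` -/
  hVmax : ∀ j, V j ≤ Vm
  /-- `ℓ ≤ V_θ` -/
  hVθℓ : ℓ ≤ Vθ
  /-- `V_θ ≤ V_max` -/
  hVθmax : Vθ ≤ Vm
  /-- `W ≥ ℓ` -/
  hWℓ : ℓ ≤ W
  /-- `1 ≤ Mcl` -/
  hMcl : 1 ≤ Mcl
  /-- `log Mcl ≤ ℓ` -/
  hMclℓ : Real.log Mcl ≤ ℓ
  /-- at least one free logarithm -/
  hd : 1 ≤ d


namespace PadicW80ParL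

variable {d : ℕ} (P : PadicW80ParL d)

/-! ### The normalised sizes -/

/-- `nVⱼ = Vⱼ/ℓ`. [cite: Yu1990, (2.30) (p. 36)] -/
def nV (j : Fin d) : ℝ := P.V j / P.ℓ

/-- `nV_θ = V_θ/ℓ`. [cite: Yu1990, (2.30) (p. 36)] -/
def nVθ : ℝ := P.Vθ / P.ℓ

/-! ### The derived parameters -/

/-- `W⋆ = max(W, m log(2¹³ m V_max))` (Waldschmidt's `W*`, (3.2)); `W⋆ ≥ W ≥ ℓ`. [cite: Waldschmidt1980, §3.2 (p. 264)] -/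
def Wstarℓ : ℝ := max P.W (mRp d * Real.log (2 ^ 13 * mRp d * P.Vm))

/-- `G = m log(2¹⁷ m V_max) + ℓ` (Waldschmidt's `log V*_{n−1}` with Yu's floor `V* ≥ p^{f}`, (2.10)).
[cite: Yu1990, (2.10) (p. 31)] [cite: Waldschmidt1980, §3.2 (p. 264)] -/
def Gℓ : ℝ := mRp d * Real.log (2 ^ 17 * mRp d * P.Vm) + P.ℓ

/-- `nW⋆ = W⋆/ℓ`. [cite: Yu1990, (2.31) (p. 36)] -/
def nWstarℓ : ℝ := P.Wstarℓ / P.ℓ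

/-- `nG = G/ℓ`. [cite: Yu1990, (2.30) (p. 36)] -/
def nGℓ : ℝ := P.Gℓ / P.ℓ

/-- **`U = Mcl · Aᵐ · m^{2m+3}/m! · (∏ nVⱼ) nV_θ · W⋆ · nG`** `= Mcl · Aᵐ m^{2m+3}/m! · (∏Vⱼ)V_θ · W⋆ · G/ℓ^{m+1}`
(Waldschmidt's `U₂` with Yu's `(f log p)^{−(n+2)}` normalisation in `ord_p · log p` units, and the class price).
[cite: Yu1990, (2.30) (p. 36)] [cite: Waldschmidt1980, §3.1 (p. 264)] -/
def Uℓ : ℝ := P.Mcl * Ap ^ (d + 1) * (mRp d ^ (2 * d + 3) / (d + 1).factorial) * ((∏ j, P.nV j) * P.nVθ) *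
  P.Wstarℓ * P.nGℓ

/-- `S₀ = 2 ⌊c_S m nW⋆⌋` (even; the points of level `0` are the odd `s < S₀`; Yu's `S = q[c₃(n+1)DW*/(f log p)]`).
[cite: Yu1990, (2.31) (p. 36)] -/
def S₀ℓ : ℕ := 2 * ⌊cSp * mRp d * P.nWstarℓ⌋₊

/-- `T = ⌊U/(c_T 2ᵐ W⋆)⌋`. [cite: Waldschmidt1980, (3.2) p. 264] -/
def Tℓ : ℕ := ⌊P.Uℓ / (cTp * 2 ^ (d + 1) * P.Wstarℓ)⌋₊

/-- `h = ⌊W⋆/G⌋ + 1` (the block length of the `Δ`-polynomials, Waldschmidt's `L₋₁ + 1`).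
[cite: Waldschmidt1980, (3.2) p. 264] -/
def hparℓ : ℕ := ⌊P.Wstarℓ / P.Gℓ⌋₊ + 1

/-- `L_b = ⌊U/(c_L 2ᵐ G h)⌋ + 1` (the number of blocks, Waldschmidt's `L₀ + 1`). [cite: Waldschmidt1980, (3.2) p. 264] -/
def Lbℓ : ℕ := ⌊P.Uℓ / (cLp * 2 ^ (d + 1) * P.Gℓ * P.hparℓ)⌋₊ + 1

/-- `Lⱼ = ⌊U/(c_L' m 2^{m+1} S₀ Vⱼ)⌋`. [cite: Waldschmidt1980, (3.2) p. 264] -/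
def Lℓ (j : Fin d) : ℕ := ⌊P.Uℓ / (cLp' * mRp d * 2 ^ (d + 2) * P.S₀ℓ * P.V j)⌋₊

/-- `L_θ = ⌊U/(c_L' m 2^{m+1} S₀ V_θ)⌋` (the smallest range). [cite: Waldschmidt1980, (3.2) p. 264] -/
def Lθℓ : ℕ := ⌊P.Uℓ / (cLp' * mRp d * 2 ^ (d + 2) * P.S₀ℓ * P.Vθ)⌋₊

/-- `J₀ = [log₂ L_θ] + 1` descent steps. [cite: Waldschmidt1980, §3.5 (p. 274)] -/
def J₀ℓ : ℕ := Nat.log 2 P.Lθℓ + 1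

/-- The unit `𝔘 = U / 2ᵐ` (`m = d + 1`). [cite: Waldschmidt1980, §3.3 (3.19) (p. 269)] -/
def 𝔘ℓ : ℝ := P.Uℓ / 2 ^ (d + 1)

/-- The common bound `𝔅 = exp(𝔘/64)` of the moderate quantities. [folklore] -/
def 𝔅ℓ : ℝ := Real.exp (P.𝔘ℓ / 64)

/-- The largest (scaled) evaluation point of the `Δ`-polynomials: `X = 66 · 2^{d+1} L_θ S₀`. [folklore] -/
def Xptℓ : ℝ := 66 * 2 ^ (d + 1) * P.Lθℓ * P.S₀ℓ

/-- All the sizes: `V` extended by `V_θ` at the last place. [folklore] -/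
def Vallℓ : Fin (d + 1) → ℝ := Fin.snoc P.V P.Vθ

/-- All the ranges: `L` extended by `L_θ`. [folklore] -/
def Lallℓ : Fin (d + 1) → ℕ := Fin.snoc P.Lℓ P.Lθℓ

/-- `t_J = ⌊(T/2ᴶ)/(2m)⌋`: the number of derivatives given up at each of the `m` inner steps of level `J`.
[cite: Waldschmidt1980, Lemma 3.6 (p. 272)] -/
def tJℓ (J : ℕ) : ℕ := P.Tℓ / 2 ^ J / (2 * (d + 1))

/-- The height unit `E(c) = exp(c · 𝔘/(2c_L'))`. [folklore] -/
def Efacℓ (c : ℝ) : ℝ := Real.exp (c * (P.𝔘ℓ / (2 * cLp')))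

/-- The coefficient bound `PrV = 2 𝔅⁵ E(2)`. [folklore] -/
def PrVℓ : ℝ := 2 * P.𝔅ℓ ^ 5 * P.Efacℓ 2

/-- `Dmax_k = 𝔅² E(2^{k+1})` (the clearing denominators of the `k`-th inner step). [folklore] -/
def DmaxKℓ (k : ℕ) : ℝ := P.𝔅ℓ ^ 2 * P.Efacℓ ((2 ^ (k + 1) : ℕ) : ℝ)

/-- `Mmax_k = 𝔅 · PrV · Dmax_k` (the archimedean size of the cores of the `k`-th inner step). [folklore] -/
def MmaxKℓ (k : ℕ) : ℝ := P.𝔅ℓ * P.PrVℓ * P.DmaxKℓ k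

/-- `DmaxH = 𝔅² E(2)` (half points). [folklore] -/
def DmaxHℓ : ℝ := P.𝔅ℓ ^ 2 * P.Efacℓ 2

/-- `MmaxH = 𝔅 · PrV · DmaxH` (half points). [folklore] -/
def MmaxHℓ : ℝ := P.𝔅ℓ * P.PrVℓ * P.DmaxHℓ

end PadicW80ParL

end Summit.ABC.StewartYu

end
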